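import Literature.NumberTheory.PAdicHodge.BdRPlusLogTypeSeries
import Literature.NumberTheory.PAdicHodge.BdRPlusLogLatticeMul
import Literature.NumberTheory.PAdicHodge.AinfRamifiedComplete
import Literature.RingTheory.FormalGroups.PadicLogTypeSeries
import HarnessLib

/-!
# `p`-adic evaluation modulo `Fil^k B_dR⁺` of logarithmic series with `𝒪_D`-numerators at points of the RAMIFIED ring
# `A_inf(𝒪) = 𝔸_inf[ϖ]` of ARBITRARY depth

Topic `Literature/NumberTheory/PAdicHodge`; namespace `Literature.NumberTheory.PAdicHodge.AinfRam`. THEOREMS ONLY (no definition, no named fact,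
no instance, no `sorry`). This is the ramified, arbitrary-depth twin of `BdRPlusLogTypeSeries` (LEAD edix-p1 g20/g21: numerators `b : ℕ → ℤ_p`,
points `y ∈ (p, ξ)𝔸_inf`, i.e. DEPTH ONE). Here the point `y` lies in Fontaine's ramified ring `A_inf(𝒪) = AinfRam D` of an Eisenstein root datum `D`
(`𝒪_D = ℤ_p[ϖ]`, tree `AinfRamified`), the numerators `β : ℕ → 𝒪_D` are ramified, and the depth is an arbitrary `n ≥ 1`: the hypothesis is only
`yⁿ ∈ (p, ξ)A_inf(𝒪)` (every element of `Ŵ(𝔫_𝒪)`, `𝔫_𝒪 = θ_𝒪⁻¹(𝔪_ℂ)`, has such an `n`). The `m`-th TERM of the series `Σ_{m≥1} (β_m/m)·ι_𝒪(y)ᵐ` is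
`(1/m)·ι_𝒪(β_m yᵐ) ∈ B_dR⁺` (`ι_𝒪 = AinfRam.toBdR`, `1/m` through `ℚ_p → B_dR⁺`); everything is measured in the tree's lattices
`Λ(j,k) = p^j ι(𝔸_inf) + ξ^k B_dR⁺` (`BdRPlusGaloisContinuity` §6):
* §1 `exists_pow_mul_toBdR_eq` — **`ι_𝒪(A_inf(𝒪))` is BOUNDED modulo `Fil^k`**: one `r = r(k)` with `p^r·ι_𝒪(x) ∈ ι(𝔸_inf) + ξ^k B_dR⁺` for ALL `x`
  (power basis `ϖⁱ`, `i < e`, and `exists_natCast_pow_mul_eq_ainfToBdR_add`);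
* §2 ★ `term_mem_lattice_of_pow_mem` — **the depth-`n` term estimate**: if `yⁿ ∈ (p,ξ)A_inf(𝒪)` then `(1/m)·ι_𝒪(β_m yᵐ) ∈ Λ(j,k)` for
  `m ≥ n·2(j + 2r + k + n)` (`yᵐ ∈ (p,ξ)^{⌊m/n⌋}`, coordinates in the power basis, `v_p(m) < ⌊m/n⌋ − k − j − 2r` from the tree's
  `PadicLogSeries.factorization_add_lt_add_div`);
* §3 ★ `partialSum_sub_partialSum_mem_lattice`, ★ `exists_value`, `value_sub_value_mem` — the partial sums are lattice-Cauchy, a VALUE `L` modulo `Fil^k`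
  exists (`∀ j, L − S_M ∈ Λ(j,k)` for `M ≫ 0`; completeness `exists_lim_of_forall_sub_mem_lattice`) and is unique modulo `ξ^k`;
* §4 `partialSum_algebraMap` — for UNRAMIFIED data (`y ∈ 𝔸_inf`, `β = ℤ_p`-numerators) the partial sums ARE the tree's `logTypePartialSum`, so the values
  are exactly the `IsLogTypeModFil`-values (any depth): the two layers agree.
No new definition: partial sums are written as explicit `Finset` sums. Purpose (crux K★ `stmt-BirchSwinnertonDyer-22226`, line `kato_lever`, memo
`Lines/kato-lever-K2-hne-direct-omega.md` F1): the evaluation layer in which the transported Hodge combination `A·P⁰ + B·Q⁰` is compared with the direct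
ramified ω-period `∫ω_{W_D}` along the SHALLOW levels of the towers. Infrastructure only: BSD / K★ are not proved by any of this.

## References
* J.-M. Fontaine, *Le corps des périodes p-adiques*, Astérisque 223 (1994), Exp. II §1.5.3–1.5.4. [FontaineAsterisque223III]
* J.-M. Fontaine, *Formes différentielles et modules de Tate des variétés abéliennes sur les corps locaux*, Invent. Math. 65 (1982), §5. [Fontaine1982FormesDifferentielles]
* P. Colmez, *Périodes p-adiques des variétés abéliennes*, Math. Ann. 292 (1992), §2. [Colmez1992PeriodesAbeliennes]
* L. Fargues, J.-M. Fontaine, *Courbes et fibrés vectoriels en théorie de Hodge p-adique*, Astérisque 406 (2018), §1.2. [FarguesFontaine2018]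
-/

noncomputable section

open ValuativeRel Field Ideal WittVector Finset

namespace Literature.NumberTheory.PAdicHodge

namespace AinfRam

open Literature.NumberTheory.GaloisRepresentations
open Literature.NumberTheory.GaloisRepresentations.IsNonarchimedeanLocalField
open GaloisContinuity Literature.RingTheory.FormalGroups

variable {F : Type} [Field F] [ValuativeRel F] [TopologicalSpace F] [IsNonarchimedeanLocalField F]
  [CharZero F] {p : ℕ} [Fact p.Prime] [Fact (¬ IsUnit (p : integerC F))]
  [IsAdicComplete (Ideal.span {(p : integerC F)}) (integerC F)]
  {hp : valuation F p < 1} (D : EisensteinRoot F p hp) (hθ : Function.Surjective (fontaineTheta (integerC F) p))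

/-! ## §1 `ι_𝒪(A_inf(𝒪))` is bounded modulo `Fil^k` -/

/-- `ι_𝒪(x) = Σᵢ ι(xᵢ)·ι_𝒪(ϖ)ⁱ` in the power basis `ϖⁱ` (`i < e`). [cite: FarguesFontaine2018, §1.2] -/
theorem toBdR_eq_sum_repr (x : AinfRam D) :
    toBdR D hθ x = ∑ i : Fin (powerBasis D).dim, ainfToBdR ((powerBasis D).basis.repr x i) * toBdR D hθ (varpi D) ^ (i : ℕ) := by
  conv_lhs => rw [← (powerBasis D).basis.sum_repr x]
  rw [map_sum]
  refine Finset.sum_congr rfl fun i _ => ?_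
  rw [Algebra.smul_def, map_mul, algebraMap_eq, ← algebraMap_eq, toBdR_algebraMap, powerBasis_basis_apply, map_pow]

/-- ★ **`ι_𝒪(A_inf(𝒪)) ⊆ p^{−r}·(ι(𝔸_inf) + ξ^k B_dR⁺)` with ONE `r = r(k)`**: the ramified integers are bounded modulo `Fil^k` (each `ι_𝒪(ϖⁱ)`,
`i < e`, is bounded by `exists_natCast_pow_mul_eq_ainfToBdR_add`, and `ι_𝒪` is `𝔸_inf`-linear in the power basis).
[cite: FontaineAsterisque223III, Exp. II §1.5.3] [cite: FarguesFontaine2018, §1.2] -/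
theorem exists_pow_mul_toBdR_eq (k : ℕ) : ∃ r : ℕ, ∀ x : AinfRam D, ∃ (a : Ainf (p := p) F) (w : BDeRhamPlus (integerC F) p),
    (p : BDeRhamPlus (integerC F) p) ^ r * toBdR D hθ x = ainfToBdR a + xiBdR ^ k * w := by
  classical
  have hb : ∀ i : Fin (powerBasis D).dim, ∃ (r : ℕ) (a : Ainf (p := p) F) (w : BDeRhamPlus (integerC F) p),
      (p : BDeRhamPlus (integerC F) p) ^ r * toBdR D hθ (varpi D) ^ (i : ℕ) = ainfToBdR a + xiBdR ^ k * w := fun i =>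
    exists_natCast_pow_mul_eq_ainfToBdR_add _ k
  choose r a w hraw using hb
  refine ⟨∑ i, r i, fun x => ?_⟩
  have hterm : ∀ i ∈ (Finset.univ : Finset (Fin (powerBasis D).dim)), ∃ (a' : Ainf (p := p) F) (w' : BDeRhamPlus (integerC F) p),
      (p : BDeRhamPlus (integerC F) p) ^ (∑ i, r i) * (ainfToBdR ((powerBasis D).basis.repr x i) * toBdR D hθ (varpi D) ^ (i : ℕ)) =
        ainfToBdR ((p : Ainf (p := p) F) ^ 0 * a') + xiBdR ^ k * w' := by
    intro i hi
    obtain ⟨s, hs⟩ : ∃ s, ∑ j, r j = r i + s := ⟨∑ j, r j - r i, (Nat.add_sub_cancel' (Finset.single_le_sum (fun j _ => Nat.zero_le (r j)) hi)).symm⟩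
    refine ⟨(powerBasis D).basis.repr x i * ((p : Ainf (p := p) F) ^ s * a i), ainfToBdR ((powerBasis D).basis.repr x i) * ((p : BDeRhamPlus (integerC F) p) ^ s * w i), ?_⟩
    have e1 : (p : BDeRhamPlus (integerC F) p) ^ (∑ j, r j) * (ainfToBdR ((powerBasis D).basis.repr x i) * toBdR D hθ (varpi D) ^ (i : ℕ)) =
        ainfToBdR ((powerBasis D).basis.repr x i) * (p : BDeRhamPlus (integerC F) p) ^ s *
          ((p : BDeRhamPlus (integerC F) p) ^ (r i) * toBdR D hθ (varpi D) ^ (i : ℕ)) := by rw [hs, pow_add]; ring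
    rw [e1, hraw i]
    simp only [map_mul, map_pow, map_natCast, pow_zero, one_mul]
    ring
  obtain ⟨a', w', h⟩ := lattice_sum (Finset.univ : Finset (Fin (powerBasis D).dim)) hterm
  refine ⟨a', w', ?_⟩
  rw [toBdR_eq_sum_repr D hθ x, Finset.mul_sum, h, pow_zero, one_mul]

/-! ## §2 The depth-`n` term estimate -/

omit [IsAdicComplete (Ideal.span {(p : integerC F)}) (integerC F)] in
/-- Powers of the extended ideal: `((p,ξ)A_inf(𝒪))^q = ((p,ξ)^q 𝔸_inf)·A_inf(𝒪)`. [cite: FontaineAsterisque223III, Exp. II §1.3] -/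
theorem idealPXi_pow (q : ℕ) : idealPXi D ^ q = (Ideal.span {(p : Ainf (p := p) F), xi} ^ q).map (algebraMap (Ainf (p := p) F) (AinfRam D)) := by
  rw [idealPXi, Ideal.map_pow]

omit [IsAdicComplete (Ideal.span {(p : integerC F)}) (integerC F)] in
/-- **Coordinates of an element of `((p,ξ)^q)A_inf(𝒪)` lie in `(p,ξ)^q`** (free module with the power basis `ϖⁱ`).
[cite: FarguesFontaine2018, §1.2] -/
theorem repr_mem_of_mem_idealPXi_pow {q : ℕ} {x : AinfRam D} (hx : x ∈ idealPXi D ^ q) (i : Fin (powerBasis D).dim) :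
    (powerBasis D).basis.repr x i ∈ Ideal.span {(p : Ainf (p := p) F), xi} ^ q := by
  rw [idealPXi_pow] at hx
  have hx' : x ∈ (Ideal.span {(p : Ainf (p := p) F), xi} ^ q) • (⊤ : Submodule (Ainf (p := p) F) (AinfRam D)) := by
    rw [Ideal.smul_top_eq_map]; exact hx
  exact (mem_smul_top_iff_of_basis (powerBasis D).basis _ x).1 hx' i

omit [IsAdicComplete (Ideal.span {(p : integerC F)}) (integerC F)] in
/-- `yᵐ ∈ ((p,ξ)A_inf(𝒪))^{⌊m/n⌋}` when `yⁿ ∈ (p,ξ)A_inf(𝒪)`. [cite: FontaineAsterisque223III, Exp. II §1.5.3] -/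
theorem pow_mem_idealPXi_pow_div {y : AinfRam D} {n : ℕ} (hy : y ^ n ∈ idealPXi D) (m : ℕ) : y ^ m ∈ idealPXi D ^ (m / n) := by
  have h : y ^ m = (y ^ n) ^ (m / n) * y ^ (m % n) := by
    rw [← pow_mul, ← pow_add, Nat.div_add_mod m n]
  rw [h]
  exact Ideal.mul_mem_right _ _ (Ideal.pow_mem_pow hy _)

omit [CharZero F] [Fact (¬ IsUnit (p : integerC F))] [IsAdicComplete (Ideal.span {(p : integerC F)}) (integerC F)]
  [ValuativeRel F] [TopologicalSpace F] [IsNonarchimedeanLocalField F] in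
/-- `p`-adic bookkeeping of the denominator: for `m ≠ 0`, `q − k − v_p(m) ≥ j` gives `(1/m)·p^{q−k} = p^j·g` with `g ∈ ℤ_p`.
[cite: FontaineAsterisque223III, Exp. II §1.5.3] -/
theorem exists_inv_natCast_mul_pow_eq {m q k j : ℕ} (hm : m ≠ 0) (h : j + k + m.factorization p ≤ q) :
    ∃ g : ℤ_[p], (m : ℚ_[p])⁻¹ * (p : ℚ_[p]) ^ (q - k) = (p : ℚ_[p]) ^ j * (g : ℚ_[p]) := by
  obtain ⟨e, m', hm', hme⟩ := Nat.exists_eq_pow_mul_and_not_dvd hm p (Fact.out : p.Prime).one_lt.ne'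
  obtain ⟨v, hv⟩ := isUnit_natCast_padicInt_of_not_dvd (p := p) hm'
  have he : e = m.factorization p := by
    rw [hme, Nat.factorization_mul (pow_ne_zero _ (Fact.out : p.Prime).ne_zero) (fun h0 => hm' (by rw [h0]; exact dvd_zero p)),
      Finsupp.add_apply, (Fact.out : p.Prime).factorization_pow, Finsupp.single_eq_same,
      Nat.factorization_eq_zero_of_not_dvd hm', add_zero]
  have hp0 : (p : ℚ_[p]) ≠ 0 := Nat.cast_ne_zero.2 (Fact.out : p.Prime).ne_zero
  have hvv : ((v : ℤ_[p]) : ℚ_[p]) * ((↑v⁻¹ : ℤ_[p]) : ℚ_[p]) = 1 := by rw [← PadicInt.coe_mul, Units.mul_inv, PadicInt.coe_one]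
  have hv0 : ((v : ℤ_[p]) : ℚ_[p]) ≠ 0 := fun h0 => by rw [h0, zero_mul] at hvv; exact zero_ne_one hvv
  refine ⟨↑v⁻¹ * (p : ℤ_[p]) ^ (q - k - j - e), ?_⟩
  have hsplit : (p : ℚ_[p]) ^ (q - k) = (p : ℚ_[p]) ^ e * ((p : ℚ_[p]) ^ j * (p : ℚ_[p]) ^ (q - k - j - e)) := by
    rw [← pow_add, ← pow_add]; congr 1; omega
  have hm1 : (m : ℚ_[p]) = (p : ℚ_[p]) ^ e * ((v : ℤ_[p]) : ℚ_[p]) := by rw [hv, PadicInt.coe_natCast]; exact_mod_cast hme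
  have hB : (((v⁻¹ : ℤ_[p]ˣ) : ℤ_[p]) : ℚ_[p]) = (((v : ℤ_[p]) : ℚ_[p]))⁻¹ := eq_inv_of_mul_eq_one_right hvv
  rw [hsplit, hm1, PadicInt.coe_mul, PadicInt.coe_pow, PadicInt.coe_natCast, hB]
  field_simp

/-- ★ **The depth-`n` term estimate.** Let `yⁿ ∈ (p,ξ)A_inf(𝒪)` (`n ≥ 1`), `β : ℕ → 𝒪_D`, and let `r` bound `ι_𝒪(A_inf(𝒪))` modulo `Fil^k` (§1). Then for
every `m ≥ n·2(j + 2r + k + n)` the `m`-th term **`(1/m)·ι_𝒪(β_m·yᵐ) ∈ Λ(j, k) = p^j ι(𝔸_inf) + ξ^k B_dR⁺`**: the numerator `β_m` and the powers `ϖⁱ`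
cost `p^{−r}` each, the denominator costs `p^{−v_p(m)}`, against `yᵐ ∈ (p,ξ)^{⌊m/n⌋} ⊆ p^{⌊m/n⌋−k}𝔸_inf + ξ^k` coordinatewise.
[cite: FontaineAsterisque223III, Exp. II §1.5.3] [cite: Colmez1992PeriodesAbeliennes, §2] -/
theorem term_mem_lattice_of_pow_mem {k r : ℕ}
    (hr : ∀ x : AinfRam D, ∃ (a : Ainf (p := p) F) (w : BDeRhamPlus (integerC F) p),
      (p : BDeRhamPlus (integerC F) p) ^ r * toBdR D hθ x = ainfToBdR a + xiBdR ^ k * w)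
    {y : AinfRam D} {n : ℕ} (hn : 1 ≤ n) (hy : y ^ n ∈ idealPXi D) (β : ℕ → D.Coeff) {j m : ℕ} (hm : n * (2 * (j + 2 * r + k + n)) ≤ m) :
    ∃ (a : Ainf (p := p) F) (w : BDeRhamPlus (integerC F) p),
      qpToBdR ((m : ℚ_[p])⁻¹) * toBdR D hθ (coeffHom D (β m) * y ^ m) = ainfToBdR ((p : Ainf (p := p) F) ^ j * a) + xiBdR ^ k * w := by
  classical
  have hm0 : m ≠ 0 := by
    intro h0; rw [h0] at hm
    have : 1 ≤ n * (2 * (j + 2 * r + k + n)) := Nat.one_le_iff_ne_zero.2 (Nat.mul_ne_zero (by omega) (by omega))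
    omega
  -- `v_p(m) + (j + 2r + k + n) < n + m/n`
  have hdiv : 2 * (j + 2 * r + k + n) ≤ m / n := (Nat.le_div_iff_mul_le (by omega)).2 (by rw [mul_comm]; exact hm)
  have hfac := PadicLogSeries.factorization_add_lt_add_div (p := p) hn hm0 hdiv
  set q := m / n with hq
  have hkq : k ≤ q := by omega
  have hjq : (j + 2 * r) + k + m.factorization p ≤ q := by omega
  obtain ⟨g, hg⟩ := exists_inv_natCast_mul_pow_eq (p := p) (j := j + 2 * r) hm0 hjq
  -- coordinates of `β_m yᵐ` in the power basis lie in `(p,ξ)^q`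
  have hmem : coeffHom D (β m) * y ^ m ∈ idealPXi D ^ q := Ideal.mul_mem_left _ _ (pow_mem_idealPXi_pow_div D hy m)
  have hcoord := repr_mem_of_mem_idealPXi_pow D hmem
  -- each coordinate contributes an element of `Λ(j + 2r, k)`, times the bounded `ι_𝒪(ϖ)ⁱ`
  have hterm : ∀ i ∈ (Finset.univ : Finset (Fin (powerBasis D).dim)), ∃ (a : Ainf (p := p) F) (w : BDeRhamPlus (integerC F) p),
      (p : BDeRhamPlus (integerC F) p) ^ r * (qpToBdR ((m : ℚ_[p])⁻¹) *
        (ainfToBdR ((powerBasis D).basis.repr (coeffHom D (β m) * y ^ m) i) * toBdR D hθ (varpi D) ^ (i : ℕ))) =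
        ainfToBdR ((p : Ainf (p := p) F) ^ (j + r) * a) + xiBdR ^ k * w := by
    intro i _
    obtain ⟨b, c, hbc⟩ := exists_eq_of_mem_span_p_xi_pow hkq (hcoord i)
    obtain ⟨aϖ, wϖ, hϖ⟩ := hr (varpi D ^ (i : ℕ))
    rw [map_pow] at hϖ
    -- `(1/m) ι(p^{q-k} b + ξ^k c) ∈ Λ(j + 2r, k)`
    have h1 : qpToBdR ((m : ℚ_[p])⁻¹) * ainfToBdR ((powerBasis D).basis.repr (coeffHom D (β m) * y ^ m) i) =
        ainfToBdR ((p : Ainf (p := p) F) ^ ((j + r) + r) * (zpToAinf g * b)) + xiBdR ^ k * (qpToBdR ((m : ℚ_[p])⁻¹) * ainfToBdR c) := by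
      have hq' : qpToBdR ((m : ℚ_[p])⁻¹) * (p : BDeRhamPlus (integerC F) p) ^ (q - k) =
          ainfToBdR ((p : Ainf (p := p) F) ^ (j + 2 * r) * zpToAinf g) := by
        rw [← map_natCast (qpToBdR (F := F) (p := p)) p, ← map_pow, ← map_mul, hg, map_mul, map_pow, map_natCast, qpToBdR_coe]
        simp only [map_mul, map_pow, map_natCast]
      rw [hbc, map_add, map_mul, map_mul, map_pow, map_natCast, map_pow, ainfToBdR_xi, mul_add, ← mul_assoc, hq',
        show (j + r) + r = j + 2 * r by ring]
      simp only [map_mul, map_pow, map_natCast]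
      ring
    have h2 : (p : BDeRhamPlus (integerC F) p) ^ r * (qpToBdR ((m : ℚ_[p])⁻¹) *
        (ainfToBdR ((powerBasis D).basis.repr (coeffHom D (β m) * y ^ m) i) * toBdR D hθ (varpi D) ^ (i : ℕ))) =
        toBdR D hθ (varpi D) ^ (i : ℕ) * ((p : BDeRhamPlus (integerC F) p) ^ r *
          (qpToBdR ((m : ℚ_[p])⁻¹) * ainfToBdR ((powerBasis D).basis.repr (coeffHom D (β m) * y ^ m) i))) := by ring
    rw [h2]
    have h3 : (p : BDeRhamPlus (integerC F) p) ^ r * (qpToBdR ((m : ℚ_[p])⁻¹) * ainfToBdR ((powerBasis D).basis.repr (coeffHom D (β m) * y ^ m) i)) =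
        ainfToBdR ((p : Ainf (p := p) F) ^ ((j + r) + r) * ((p : Ainf (p := p) F) ^ r * (zpToAinf g * b))) +
          xiBdR ^ k * ((p : BDeRhamPlus (integerC F) p) ^ r * (qpToBdR ((m : ℚ_[p])⁻¹) * ainfToBdR c)) := by
      rw [h1]; simp only [map_mul, map_pow, map_natCast]; ring
    exact lattice_mul_of_bounded hϖ h3
  obtain ⟨a', w', hsum⟩ := lattice_sum (Finset.univ : Finset (Fin (powerBasis D).dim)) hterm
  -- multiply by the bounded numerator `ι_𝒪(β_m)` (cost `r`) and divide out `p^{2r}`? No: we kept `p^r` on the left; use the numerator bound now.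
  obtain ⟨aβ, wβ, hβ⟩ := hr (coeffHom D (β m))
  -- assemble over the power basis and divide by `p^r`
  have hmain : (p : BDeRhamPlus (integerC F) p) ^ r * (qpToBdR ((m : ℚ_[p])⁻¹) * toBdR D hθ (coeffHom D (β m) * y ^ m)) =
      ainfToBdR ((p : Ainf (p := p) F) ^ (j + r) * a') + xiBdR ^ k * w' := by
    rw [toBdR_eq_sum_repr D hθ (coeffHom D (β m) * y ^ m), Finset.mul_sum, Finset.mul_sum, hsum]
  -- divide by `p^r`: `p^r x = ι(p^{j+r} a') + ξ^k w'` ⟹ `x = ι(p^j a') + ξ^k (u w')` with `p^r u = 1`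
  obtain ⟨u, hu⟩ : ∃ u : BDeRhamPlus (integerC F) p, (p : BDeRhamPlus (integerC F) p) ^ r * u = 1 := by
    obtain ⟨v, hv⟩ := (isUnit_natCast_bDeRhamPlus (F := F) (p := p) (Fact.out : p.Prime).ne_zero).pow r
    exact ⟨↑v⁻¹, by rw [← hv, Units.mul_inv]⟩
  refine ⟨a', u * w', ?_⟩
  have e1 : qpToBdR ((m : ℚ_[p])⁻¹) * toBdR D hθ (coeffHom D (β m) * y ^ m) =
      u * ((p : BDeRhamPlus (integerC F) p) ^ r * (qpToBdR ((m : ℚ_[p])⁻¹) * toBdR D hθ (coeffHom D (β m) * y ^ m))) := by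
    rw [← mul_assoc, mul_comm u, hu, one_mul]
  rw [e1, hmain, pow_add]
  simp only [map_mul, map_pow, map_natCast]
  linear_combination (ainfToBdR a' * (p : BDeRhamPlus (integerC F) p) ^ j) * hu

/-! ## §3 Partial sums are lattice-Cauchy; values modulo `Fil^k` exist and are unique -/

/-- ★ **The partial sums `S_M = Σ_{m=1}^{M} (1/m)·ι_𝒪(β_m yᵐ)` are lattice-Cauchy**: `S_N − S_M ∈ Λ(j,k)` for `n·2(j+2r+k+n) ≤ M ≤ N`.
[cite: FontaineAsterisque223III, Exp. II §1.5.3] -/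
theorem partialSum_sub_partialSum_mem_lattice {k r : ℕ}
    (hr : ∀ x : AinfRam D, ∃ (a : Ainf (p := p) F) (w : BDeRhamPlus (integerC F) p),
      (p : BDeRhamPlus (integerC F) p) ^ r * toBdR D hθ x = ainfToBdR a + xiBdR ^ k * w)
    {y : AinfRam D} {n : ℕ} (hn : 1 ≤ n) (hy : y ^ n ∈ idealPXi D) (β : ℕ → D.Coeff) {j M N : ℕ}
    (hM : n * (2 * (j + 2 * r + k + n)) ≤ M) (hMN : M ≤ N) :
    ∃ (a : Ainf (p := p) F) (w : BDeRhamPlus (integerC F) p),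
      (∑ m ∈ Finset.range N, qpToBdR (((m + 1 : ℕ) : ℚ_[p])⁻¹) * toBdR D hθ (coeffHom D (β (m + 1)) * y ^ (m + 1))) -
        (∑ m ∈ Finset.range M, qpToBdR (((m + 1 : ℕ) : ℚ_[p])⁻¹) * toBdR D hθ (coeffHom D (β (m + 1)) * y ^ (m + 1))) =
        ainfToBdR ((p : Ainf (p := p) F) ^ j * a) + xiBdR ^ k * w := by
  induction N, hMN using Nat.le_induction with
  | base => exact ⟨0, 0, by simp⟩
  | succ N hMN ih =>
    obtain ⟨a, w, h⟩ := ih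
    obtain ⟨a', w', h'⟩ := term_mem_lattice_of_pow_mem D hθ hr hn hy β (j := j) (m := N + 1) (by omega)
    refine ⟨a + a', w + w', ?_⟩
    rw [Finset.sum_range_succ, add_sub_right_comm]
    exact lattice_add h h'

/-- ★ **Existence of a value modulo `Fil^k`**: for `yⁿ ∈ (p,ξ)A_inf(𝒪)` there is `L ∈ B_dR⁺` with `L − S_M ∈ Λ(j,k)` for all `M ≫_j 0` — the `p`-adic value
of `Σ (β_m/m)·ι_𝒪(y)ᵐ` in `B_dR⁺/Fil^k` (completeness `exists_lim_of_forall_sub_mem_lattice`). [cite: FontaineAsterisque223III, Exp. II §1.5.3–1.5.4] -/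
theorem exists_value {k r : ℕ}
    (hr : ∀ x : AinfRam D, ∃ (a : Ainf (p := p) F) (w : BDeRhamPlus (integerC F) p),
      (p : BDeRhamPlus (integerC F) p) ^ r * toBdR D hθ x = ainfToBdR a + xiBdR ^ k * w)
    {y : AinfRam D} {n : ℕ} (hn : 1 ≤ n) (hy : y ^ n ∈ idealPXi D) (β : ℕ → D.Coeff) :
    ∃ L : BDeRhamPlus (integerC F) p, ∀ j : ℕ, ∃ M₀ : ℕ, ∀ M : ℕ, M₀ ≤ M → ∃ (a : Ainf (p := p) F) (w : BDeRhamPlus (integerC F) p),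
      L - (∑ m ∈ Finset.range M, qpToBdR (((m + 1 : ℕ) : ℚ_[p])⁻¹) * toBdR D hθ (coeffHom D (β (m + 1)) * y ^ (m + 1))) =
        ainfToBdR ((p : Ainf (p := p) F) ^ j * a) + xiBdR ^ k * w := by
  set S : ℕ → BDeRhamPlus (integerC F) p := fun M =>
    ∑ m ∈ Finset.range M, qpToBdR (((m + 1 : ℕ) : ℚ_[p])⁻¹) * toBdR D hθ (coeffHom D (β (m + 1)) * y ^ (m + 1)) with hS
  set M₀ : ℕ → ℕ := fun j => n * (2 * (j + 2 * r + k + n)) with hM₀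
  have hmono : ∀ j, M₀ j ≤ M₀ (j + 1) := fun j => Nat.mul_le_mul_left _ (by omega)
  obtain ⟨L, s, hL⟩ := exists_lim_of_forall_sub_mem_lattice (x := fun j => S (M₀ j)) (k := k)
    (fun N => partialSum_sub_partialSum_mem_lattice D hθ hr hn hy β le_rfl (hmono N))
  refine ⟨L, fun j => ⟨M₀ (j + s), fun M hM => ?_⟩⟩
  obtain ⟨a, w, h1⟩ := hL j (j + s) le_rfl
  obtain ⟨a', w', h2⟩ := partialSum_sub_partialSum_mem_lattice D hθ hr hn hy β (j := j + s) le_rfl hM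
  obtain ⟨a'', w'', h3⟩ := lattice_mono (show j ≤ j + s by omega) le_rfl h2
  refine ⟨a - a'', w - w'', ?_⟩
  have e : L - S M = (L - S (M₀ (j + s))) - (S M - S (M₀ (j + s))) := by ring
  rw [e]
  exact lattice_sub h1 h3

/-- ★ **Uniqueness modulo `Fil^k`**: two values of the same series at the same point differ by an element of `ξ^k B_dR⁺`.
[cite: FontaineAsterisque223III, Exp. II §1.5.3] -/
theorem value_sub_value_mem {k : ℕ} {y : AinfRam D} (β : ℕ → D.Coeff) {L L' : BDeRhamPlus (integerC F) p}
    (hL : ∀ j : ℕ, ∃ M₀ : ℕ, ∀ M : ℕ, M₀ ≤ M → ∃ (a : Ainf (p := p) F) (w : BDeRhamPlus (integerC F) p),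
      L - (∑ m ∈ Finset.range M, qpToBdR (((m + 1 : ℕ) : ℚ_[p])⁻¹) * toBdR D hθ (coeffHom D (β (m + 1)) * y ^ (m + 1))) =
        ainfToBdR ((p : Ainf (p := p) F) ^ j * a) + xiBdR ^ k * w)
    (hL' : ∀ j : ℕ, ∃ M₀ : ℕ, ∀ M : ℕ, M₀ ≤ M → ∃ (a : Ainf (p := p) F) (w : BDeRhamPlus (integerC F) p),
      L' - (∑ m ∈ Finset.range M, qpToBdR (((m + 1 : ℕ) : ℚ_[p])⁻¹) * toBdR D hθ (coeffHom D (β (m + 1)) * y ^ (m + 1))) =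
        ainfToBdR ((p : Ainf (p := p) F) ^ j * a) + xiBdR ^ k * w) :
    L - L' ∈ Ideal.span {(xiBdR : BDeRhamPlus (integerC F) p) ^ k} := by
  refine sub_mem_span_xiBdR_pow_of_forall_lattice_lim
    (x := fun M => ∑ m ∈ Finset.range M, qpToBdR (((m + 1 : ℕ) : ℚ_[p])⁻¹) * toBdR D hθ (coeffHom D (β (m + 1)) * y ^ (m + 1))) fun N => ?_
  obtain ⟨M₀, h⟩ := hL N
  obtain ⟨M₀', h'⟩ := hL' N
  obtain ⟨a, w, h1⟩ := h (max M₀ M₀') (le_max_left _ _)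
  obtain ⟨a', w', h2⟩ := h' (max M₀ M₀') (le_max_right _ _)
  exact ⟨max M₀ M₀', a, w, h1, a', w', h2⟩

/-- Invariance of «being a value modulo `Fil^k`» under `ξ^k B_dR⁺`. [cite: FontaineAsterisque223III, Exp. II §1.5.3] -/
theorem value_of_sub_mem {k : ℕ} {y : AinfRam D} (β : ℕ → D.Coeff) {L L' : BDeRhamPlus (integerC F) p}
    (hL : ∀ j : ℕ, ∃ M₀ : ℕ, ∀ M : ℕ, M₀ ≤ M → ∃ (a : Ainf (p := p) F) (w : BDeRhamPlus (integerC F) p),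
      L - (∑ m ∈ Finset.range M, qpToBdR (((m + 1 : ℕ) : ℚ_[p])⁻¹) * toBdR D hθ (coeffHom D (β (m + 1)) * y ^ (m + 1))) =
        ainfToBdR ((p : Ainf (p := p) F) ^ j * a) + xiBdR ^ k * w)
    (h : L' - L ∈ Ideal.span {(xiBdR : BDeRhamPlus (integerC F) p) ^ k}) :
    ∀ j : ℕ, ∃ M₀ : ℕ, ∀ M : ℕ, M₀ ≤ M → ∃ (a : Ainf (p := p) F) (w : BDeRhamPlus (integerC F) p),
      L' - (∑ m ∈ Finset.range M, qpToBdR (((m + 1 : ℕ) : ℚ_[p])⁻¹) * toBdR D hθ (coeffHom D (β (m + 1)) * y ^ (m + 1))) =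
        ainfToBdR ((p : Ainf (p := p) F) ^ j * a) + xiBdR ^ k * w := by
  obtain ⟨c, hc⟩ := Ideal.mem_span_singleton'.1 h
  intro j
  obtain ⟨M₀, hM₀⟩ := hL j
  refine ⟨M₀, fun M hM => ?_⟩
  obtain ⟨a, w, h1⟩ := hM₀ M hM
  refine ⟨a, w + c, ?_⟩
  rw [show L' - (∑ m ∈ Finset.range M, qpToBdR (((m + 1 : ℕ) : ℚ_[p])⁻¹) * toBdR D hθ (coeffHom D (β (m + 1)) * y ^ (m + 1))) =
    (L - ∑ m ∈ Finset.range M, qpToBdR (((m + 1 : ℕ) : ℚ_[p])⁻¹) * toBdR D hθ (coeffHom D (β (m + 1)) * y ^ (m + 1))) + (L' - L) by ring,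
    h1, ← hc]
  ring

/-! ## §4 Unramified data: the partial sums are the tree's `logTypePartialSum` -/

/-- The `m`-th term at an unramified point with `ℤ_p`-numerators is the tree's `logTypeTerm`. [cite: FontaineAsterisque223III, Exp. II §1.5.3] -/
theorem term_algebraMap (b : ℕ → ℤ_[p]) (y₀ : Ainf (p := p) F) (m : ℕ) :
    qpToBdR ((m : ℚ_[p])⁻¹) * toBdR D hθ (coeffHom D (AdjoinRoot.of D.poly (b m)) * algebraMap (Ainf (p := p) F) (AinfRam D) y₀ ^ m) =
      logTypeTerm b y₀ m := by
  rw [logTypeTerm, coeffHom_of, ← map_pow, ← map_mul, toBdR_algebraMap, map_mul, map_pow, ← qpToBdR_coe, ← mul_assoc, ← map_mul,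
    inv_mul_eq_div]

/-- ★ **Agreement with the depth-one / unramified layer**: at `y = y₀ ∈ 𝔸_inf` with numerators `b : ℕ → ℤ_p` the partial sums ARE
`logTypePartialSum b y₀ M`; hence the values modulo `Fil^k` of this file are exactly the `IsLogTypeModFil b k y₀ ·`-values of `BdRPlusLogTypeSeries`
(for ANY depth of `y₀`, e.g. the values `f(Λ_N(ι y₀, z)) = p^N·L′` of `BmaxPlusToBdRPeriods`). [cite: FontaineAsterisque223III, Exp. II §1.5.3–1.5.4] -/
theorem partialSum_algebraMap (b : ℕ → ℤ_[p]) (y₀ : Ainf (p := p) F) (M : ℕ) :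
    (∑ m ∈ Finset.range M, qpToBdR (((m + 1 : ℕ) : ℚ_[p])⁻¹) *
      toBdR D hθ (coeffHom D (AdjoinRoot.of D.poly (b (m + 1))) * algebraMap (Ainf (p := p) F) (AinfRam D) y₀ ^ (m + 1))) =
      logTypePartialSum b y₀ M := by
  rw [logTypePartialSum]
  exact Finset.sum_congr rfl fun m _ => term_algebraMap D hθ b y₀ (m + 1)

/-- **The two predicates coincide for unramified data**: `IsLogTypeModFil b k y₀ L` iff `L` is a value (in the sense of §3) of the series with numerators
`of ∘ b` at `algebraMap y₀`. [cite: FontaineAsterisque223III, Exp. II §1.5.4] -/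
theorem isLogTypeModFil_iff_value (b : ℕ → ℤ_[p]) (k : ℕ) (y₀ : Ainf (p := p) F) (L : BDeRhamPlus (integerC F) p) :
    IsLogTypeModFil b k y₀ L ↔ ∀ j : ℕ, ∃ M₀ : ℕ, ∀ M : ℕ, M₀ ≤ M → ∃ (a : Ainf (p := p) F) (w : BDeRhamPlus (integerC F) p),
      L - (∑ m ∈ Finset.range M, qpToBdR (((m + 1 : ℕ) : ℚ_[p])⁻¹) *
        toBdR D hθ (coeffHom D (AdjoinRoot.of D.poly (b (m + 1))) * algebraMap (Ainf (p := p) F) (AinfRam D) y₀ ^ (m + 1))) =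
        ainfToBdR ((p : Ainf (p := p) F) ^ j * a) + xiBdR ^ k * w := by
  simp only [IsLogTypeModFil, partialSum_algebraMap]

end AinfRam

end Literature.NumberTheory.PAdicHodge

end
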